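import Summits.Ventures.HodgeRepro2.T5LandherrInvariantsIff
import Summits.Ventures.HodgeRepro2.T5HermitianClassify

/-!
# The rank-one instance of the Hasse-principle display is the Hasse norm theorem for `K/K⁺`
(cell pub-hodge-repro2, seat p3)

Tier-5 N2 support, rows N2.2.7 / N2.2.9 / N2.8.1 of route/T5-N2-route-3.md; towards the converse of file 161. File
161 proves `GrossBH2021_Thm3_1_uniqueness K (Fin 2) → T6.Hyp.Shimura2008_Thm2_2_i K` (the Hasse principle for rank-2
hermitian forms gives Shimura's classification by `(n, {σ_v}, d₀)`); the converse needs, in addition, that a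
determinant ratio which is a local norm everywhere is a global norm — the Hasse norm theorem for the quadratic
extension `K/K⁺`. This file identifies that statement EXACTLY with the rank-one instance of the display, with no
new display:
* `isCongruent_diagonal_const_iff`: two `1 × 1` Gram matrices `(a)`, `(a')` are congruent iff `a' = u ū a`
  (file 134's `IsCongruent.exists_det_eq`, file 130's `isCongruent_of_unique`); `isCongruent_diagonal_const_one_of_pos`,
  `isCongruent_map_diagonal_const_of_pos`, `re_pos_of_isCongruent_map_diagonal_const`: over `ℂ`, `(1)` and `(a)` are
  congruent iff `a > 0`;
* `totallyPositive_iff`: `(φ c).re > 0` for every embedding `φ : K → ℂ` iff `ψ c > 0` for every real embedding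
  `ψ : K⁺ → ℝ` (Mathlib's `IsReal.embedding` and `ComplexEmbedding.lift`);
* `isNormSqrt_iff_hilbertFin_eq_one`: at a finite place `v` of `K⁺`, `(c, θ)_v = 1` iff `c` is a local norm at `v`
  (`c = x² − θ y²` in `K⁺_v`; file 133's `hilbertSolvable_iff_isNormSqrt`);
* **`grossBH2021_Fin1_iff`** / **`grossBH2021_Fin1_iff_localNorm`** — THE RANK-ONE INSTANCE OF THE DISPLAY IS THE
  HASSE NORM THEOREM: `GrossBH2021_Thm3_1_uniqueness K (Fin 1)` holds iff every `c ∈ K⁺^×` which is a local norm at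
  every finite place of `K⁺` and at every real place (`c > 0`: every real place of `K⁺` ramifies in the totally
  complex `K`) is a global norm `z · star z`, `z ∈ K` — the statement of Hasse's norm theorem for `K/K⁺` (not
  displayed, not used); `⇒` = `exists_mul_star_eq_of_grossBH2021_Fin1` (apply the display to `(1)` and `(c)`), `⇐` =
  `grossBH2021_Fin1_of_hasseNorm` (the ratio of two `1 × 1` entries congruent at every place is a local norm
  everywhere, file 156).
File 165 (T5LandherrDisplaysEquiv) closes the circle: `GrossBH2021_Thm3_1_uniqueness K (Fin 2) ↔
GrossBH2021_Thm3_1_uniqueness K (Fin 1) ∧ T6.Hyp.Shimura2008_Thm2_2_i K`. Nothing here is consumed by the M-chain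
(the composition of record takes N2 through the display-free `N2_main_explicit`); the file serves the referees'
faithfulness reading of the displays (README §10.5 (i)).

Mathlib + this seat's files 130 / 133 / 134 / 156 / 158 / 161 / 163 and their imports; no new display; no device.
§8(d): uses an L-value-free non-vanishing device: NO.
-/

namespace Summit.Ventures.HodgeRepro2.T5LandherrRankOne

open Matrix NumberField NumberField.IsCMField IsDedekindDomain IsDedekindDomain.HeightOneSpectrum
open Summit.Ventures.HodgeRepro2.T5HermitianDetClass Summit.Ventures.HodgeRepro2.T5HermitianGlobalChain
  Summit.Ventures.HodgeRepro2.T5GramIsometry Summit.Ventures.HodgeRepro2.T5GramSignature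
  Summit.Ventures.HodgeRepro2.T5LandherrInvariants Summit.Ventures.HodgeRepro2.T5LandherrInvariantsIff
  Summit.Ventures.HodgeRepro2.T5HermitianDiagonalize Summit.Ventures.HodgeRepro2.T5HermitianClassify
  Summit.Ventures.HodgeRepro2.T5HilbertSymbolNorm Summit.Ventures.HodgeRepro2.T5HilbertSymbolPlaces
  Summit.Ventures.HodgeRepro2.T6.B1Carriers

/-! ## `1 × 1` Gram matrices -/

section RankOne

variable {E : Type*} [Field E] [StarRing E]

/-- The `1 × 1` Gram matrix `(a)` is hermitian iff `star a = a`. -/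
theorem isHermitian_diagonal_const {a : E} (ha : star a = a) :
    (diagonal fun _ : Fin 1 => a).IsHermitian :=
  isHermitian_diagonal_iff.mpr fun _ => ha

omit [StarRing E] in
/-- The determinant of `(a)` is `a`. -/
theorem det_diagonal_const (a : E) : (diagonal fun _ : Fin 1 => a).det = a := by
  rw [det_diagonal, Fintype.prod_unique]

omit [StarRing E] in
/-- `(a)` is invertible iff `a ≠ 0`. -/
theorem isUnit_det_diagonal_const {a : E} (ha : a ≠ 0) : IsUnit (diagonal fun _ : Fin 1 => a).det := by
  rw [det_diagonal_const, isUnit_iff_ne_zero]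
  exact ha

/-- **`1 × 1` congruence is the norm class:** `(a)` and `(a')` are congruent iff `a' = star u · u · a` for some
`u ≠ 0`. -/
theorem isCongruent_diagonal_const_iff (a a' : E) :
    IsCongruent (diagonal fun _ : Fin 1 => a) (diagonal fun _ : Fin 1 => a') ↔
      ∃ u : E, u ≠ 0 ∧ a' = star u * u * a := by
  constructor
  · intro h
    obtain ⟨u, hu, hdet⟩ := h.exists_det_eq
    rw [det_diagonal_const, det_diagonal_const] at hdet
    exact ⟨u, hu.ne_zero, hdet⟩
  · rintro ⟨u, hu, hau⟩
    refine isCongruent_of_unique ⟨u, hu, ?_⟩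
    rw [det_diagonal_const, det_diagonal_const, hau]

omit [StarRing E] in
/-- The image of `(a)` under a ring homomorphism is `(f a)`. -/
theorem map_diagonal_const {F : Type*} [Field F] (f : E →+* F) (a : E) :
    (diagonal fun _ : Fin 1 => a).map f = diagonal fun _ : Fin 1 => f a := by
  rw [diagonal_map (map_zero f)]

end RankOne

/-! ## The real places: `(1)` and `(a)` are congruent over `ℂ` under `φ` iff `φ a > 0` -/

section Real

variable {K : Type*} [Field K] [NumberField K] [IsCMField K]

/-- Over `ℂ`, `(1)` and `(r)` with `r > 0` real are congruent (`u = √r`). -/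
theorem isCongruent_diagonal_const_one_of_pos {r : ℝ} (hr : 0 < r) :
    IsCongruent (diagonal fun _ : Fin 1 => (1 : ℂ)) (diagonal fun _ : Fin 1 => (r : ℂ)) := by
  refine (isCongruent_diagonal_const_iff _ _).mpr ⟨(Real.sqrt r : ℂ), ?_, ?_⟩
  · exact_mod_cast (Real.sqrt_pos.mpr hr).ne'
  · rw [Complex.star_def, Complex.conj_ofReal, mul_one, ← Complex.ofReal_mul, Real.mul_self_sqrt hr.le]

/-- For a totally real `a ∈ K` with `(φ a).re > 0`, the images of `(1)` and `(a)` under `φ` are congruent. -/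
theorem isCongruent_map_diagonal_const_of_pos (φ : K →+* ℂ) {a : K} (ha : star a = a)
    (hpos : 0 < (φ a).re) :
    IsCongruent ((diagonal fun _ : Fin 1 => (1 : K)).map φ) ((diagonal fun _ : Fin 1 => a).map φ) := by
  rw [map_diagonal_const, map_diagonal_const, map_one, ← ofReal_re_eq φ ha]
  exact isCongruent_diagonal_const_one_of_pos hpos

omit [NumberField K] [IsCMField K] in
/-- Conversely, congruence of the images of `(1)` and `(a)` under `φ` forces `(φ a).re > 0`. -/
theorem re_pos_of_isCongruent_map_diagonal_const (φ : K →+* ℂ) {a : K}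
    (h : IsCongruent ((diagonal fun _ : Fin 1 => (1 : K)).map φ) ((diagonal fun _ : Fin 1 => a).map φ)) :
    0 < (φ a).re := by
  rw [map_diagonal_const, map_diagonal_const, map_one, isCongruent_diagonal_const_iff] at h
  obtain ⟨u, hu, hau⟩ := h
  rw [hau, mul_one, Complex.star_def, ← Complex.normSq_eq_conj_mul_self, Complex.ofReal_re]
  exact Complex.normSq_pos.mpr hu

/-- **Total positivity, two readings:** `(φ c).re > 0` for every embedding `φ : K → ℂ` iff `ψ c > 0` for every real
embedding `ψ : K⁺ → ℝ` (every `φ` restricts to a real embedding of the totally real `K⁺`, and every `ψ` lifts to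
some `φ`: Mathlib's `IsReal.embedding` and `ComplexEmbedding.lift`). -/
theorem totallyPositive_iff (c : maximalRealSubfield K) :
    (∀ φ : K →+* ℂ, 0 < (φ (algebraMap (maximalRealSubfield K) K c)).re) ↔
      ∀ ψ : maximalRealSubfield K →+* ℝ, 0 < ψ c := by
  constructor
  · intro h ψ
    have := h (ComplexEmbedding.lift K (Complex.ofRealHom.comp ψ))
    rwa [ComplexEmbedding.lift_algebraMap_apply, RingHom.comp_apply, Complex.ofRealHom_eq_coe,
      Complex.ofReal_re] at this
  · intro h φ
    have hre : ComplexEmbedding.IsReal (φ.comp (algebraMap (maximalRealSubfield K) K)) :=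
      IsTotallyReal.complexEmbedding_isReal _
    have := h hre.embedding
    have hc : ((hre.embedding c : ℝ) : ℂ) = φ (algebraMap (maximalRealSubfield K) K c) :=
      hre.coe_embedding_apply c
    rw [← hc, Complex.ofReal_re]
    exact this

end Real

/-! ## The finite places: `(c, θ)_v = 1` is «`c` is a local norm at `v`» -/

section Finite

variable {K : Type*} [Field K] [NumberField K] [IsCMField K]
variable {θ : maximalRealSubfield K} {y : K}
  (hθ : algebraMap (maximalRealSubfield K) K θ = y ^ 2) (hy : complexConj K y ≠ y)

include hθ hy in
/-- `(c, θ)_v = 1` iff `c` is a norm from `K⁺_v(√θ)` (a local norm at `v`: O'Meara §65A, t6-p4's `IsNormFrom`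
shape — `c = x² − θ y²` in `K⁺_v`; file 133's `hilbertSolvable_iff_isNormSqrt`). -/
theorem isNormSqrt_iff_hilbertFin_eq_one (v : HeightOneSpectrum (𝓞 (maximalRealSubfield K)))
    {c : maximalRealSubfield K} (hc : c ≠ 0) :
    IsNormSqrt (algebraMap (maximalRealSubfield K) (v.adicCompletion (maximalRealSubfield K)) θ)
        (algebraMap (maximalRealSubfield K) (v.adicCompletion (maximalRealSubfield K)) c) ↔
      hilbertFin (maximalRealSubfield K) v c θ = 1 := by
  haveI : CharZero (v.adicCompletion (maximalRealSubfield K)) :=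
    charZero_of_injective_algebraMap (algebraMap ℚ (v.adicCompletion (maximalRealSubfield K))).injective
  haveI : NeZero (2 : v.adicCompletion (maximalRealSubfield K)) := ⟨two_ne_zero⟩
  rw [hilbertFin_eq_one_iff,
    hilbertSolvable_iff_isNormSqrt ((map_ne_zero _).mpr hc) ((map_ne_zero _).mpr (theta_ne_zero hθ hy))]

end Finite

/-! ## The rank-one display is the Hasse norm theorem for `K/K⁺` -/

section HasseNorm

variable {K : Type*} [Field K] [NumberField K] [IsCMField K]
variable {θ : maximalRealSubfield K} {y : K}
  (hθ : algebraMap (maximalRealSubfield K) K θ = y ^ 2) (hy : complexConj K y ≠ y)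

include hθ hy in
/-- **The rank-one display gives the Hasse norm theorem:** if `c ∈ K⁺^×` has `(c, θ)_v = 1` at every finite place
`v` of `K⁺` and is positive under every embedding, then `c = z · star z` for some `z ∈ K` — apply
`GrossBH2021_Thm3_1_uniqueness K (Fin 1)` to `(1)` and `(c)`: locally congruent at every finite place
(file 156's `hilbertFin_eq_one_iff_locallyCongruent`) and congruent under every `φ` (`c > 0`). -/
theorem exists_mul_star_eq_of_grossBH2021_Fin1 (hG : GrossBH2021_Thm3_1_uniqueness K (Fin 1))
    {c : maximalRealSubfield K} (hc : c ≠ 0)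
    (hfin : ∀ v : HeightOneSpectrum (𝓞 (maximalRealSubfield K)), hilbertFin (maximalRealSubfield K) v c θ = 1)
    (hpos : ∀ φ : K →+* ℂ, 0 < (φ (algebraMap (maximalRealSubfield K) K c)).re) :
    ∃ z : K, z * star z = algebraMap (maximalRealSubfield K) K c := by
  set a : K := algebraMap (maximalRealSubfield K) K c with ha
  have hsa : star a = a := complexConj_apply_eq_self K c
  have ha0 : a ≠ 0 := (map_ne_zero _).mpr hc
  have hH : (diagonal fun _ : Fin 1 => (1 : K)).IsHermitian := isHermitian_diagonal_const (star_one K)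
  have hH' : (diagonal fun _ : Fin 1 => a).IsHermitian := isHermitian_diagonal_const hsa
  have hdet : IsUnit (diagonal fun _ : Fin 1 => (1 : K)).det := isUnit_det_diagonal_const one_ne_zero
  have hdet' : IsUnit (diagonal fun _ : Fin 1 => a).det := isUnit_det_diagonal_const ha0
  have hc' : (diagonal fun _ : Fin 1 => a).det = a * (diagonal fun _ : Fin 1 => (1 : K)).det := by
    rw [det_diagonal_const, det_diagonal_const, mul_one]
  have hloc : ∀ v : HeightOneSpectrum (𝓞 (maximalRealSubfield K)),
      LocallyCongruent K v (diagonal fun _ : Fin 1 => (1 : K)) (diagonal fun _ : Fin 1 => a) :=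
    fun v => (hilbertFin_eq_one_iff_locallyCongruent hθ hy v hH hH' hdet hdet' hc hc').mp (hfin v)
  have hreal : ∀ φ : K →+* ℂ,
      IsCongruent ((diagonal fun _ : Fin 1 => (1 : K)).map φ) ((diagonal fun _ : Fin 1 => a).map φ) :=
    fun φ => isCongruent_map_diagonal_const_of_pos φ hsa (hpos φ)
  obtain ⟨u, -, hau⟩ := (isCongruent_diagonal_const_iff _ _).mp (hG _ _ hH hH' hdet hdet' hloc hreal)
  exact ⟨u, by rw [hau, mul_one, mul_comm]⟩

include hθ hy in
/-- **The Hasse norm theorem gives the rank-one display:** if every `c ∈ K⁺^×` which is a local norm at every place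
is a global norm, then `GrossBH2021_Thm3_1_uniqueness K (Fin 1)` holds — for `(a)`, `(a')` locally congruent
everywhere, `c := a'/a ∈ K⁺` has `(c, θ)_v = 1` at every finite `v` (file 156) and is positive under every embedding
(file 156's `re_pos_of_isCongruent_map`), so `c = z · star z` and the two matrices are congruent. -/
theorem grossBH2021_Fin1_of_hasseNorm
    (hN : ∀ c : maximalRealSubfield K, c ≠ 0 →
      (∀ v : HeightOneSpectrum (𝓞 (maximalRealSubfield K)), hilbertFin (maximalRealSubfield K) v c θ = 1) →
      (∀ φ : K →+* ℂ, 0 < (φ (algebraMap (maximalRealSubfield K) K c)).re) →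
      ∃ z : K, z * star z = algebraMap (maximalRealSubfield K) K c) :
    GrossBH2021_Thm3_1_uniqueness K (Fin 1) := by
  intro H H' hH hH' hdet hdet' hloc hreal
  obtain ⟨d, hd⟩ : ∃ d : maximalRealSubfield K, algebraMap (maximalRealSubfield K) K d = H.det :=
    ⟨⟨H.det, det_mem_maximalRealSubfield hH⟩, rfl⟩
  obtain ⟨d', hd'⟩ : ∃ d' : maximalRealSubfield K, algebraMap (maximalRealSubfield K) K d' = H'.det :=
    ⟨⟨H'.det, det_mem_maximalRealSubfield hH'⟩, rfl⟩
  have hd0 : d ≠ 0 := by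
    rintro rfl
    rw [map_zero] at hd
    exact hdet.ne_zero hd.symm
  have hd0' : d' ≠ 0 := by
    rintro rfl
    rw [map_zero] at hd'
    exact hdet'.ne_zero hd'.symm
  have hc0 : d' / d ≠ 0 := div_ne_zero hd0' hd0
  have hc' : H'.det = algebraMap (maximalRealSubfield K) K (d' / d) * H.det := by
    rw [← hd, ← hd', map_div₀, div_mul_cancel₀ _ ((map_ne_zero _).mpr hd0)]
  have hfin : ∀ v : HeightOneSpectrum (𝓞 (maximalRealSubfield K)),
      hilbertFin (maximalRealSubfield K) v (d' / d) θ = 1 :=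
    fun v => (hilbertFin_eq_one_iff_locallyCongruent hθ hy v hH hH' hdet hdet' hc0 hc').mpr (hloc v)
  have hpos : ∀ φ : K →+* ℂ, 0 < (φ (algebraMap (maximalRealSubfield K) K (d' / d))).re :=
    fun φ => re_pos_of_isCongruent_map hdet hc' (φ.comp (algebraMap (maximalRealSubfield K) K)) φ rfl (hreal φ)
  obtain ⟨z, hz⟩ := hN (d' / d) hc0 hfin hpos
  have hz0 : z ≠ 0 := by
    rintro rfl
    rw [zero_mul, eq_comm, map_eq_zero] at hz
    exact hc0 hz
  refine isCongruent_of_unique ⟨z, hz0, ?_⟩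
  rw [hc', ← hz, mul_comm z (star z)]

include hθ hy in
/-- **THE RANK-ONE INSTANCE OF THE HASSE-PRINCIPLE DISPLAY IS THE HASSE NORM THEOREM FOR `K/K⁺`:**
`GrossBH2021_Thm3_1_uniqueness K (Fin 1)` holds iff every `c ∈ K⁺^×` which is a local norm at every finite place
(`(c, θ)_v = 1`) and at every real place (`c > 0` under every embedding — every real place of `K⁺` ramifies in the
totally complex `K`) is a global norm `z · star z`, `z ∈ K`. The right-hand side is the statement of Hasse's norm
theorem for the cyclic extension `K/K⁺` (a theorem of global class field theory, absent from Mathlib at the pin;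
NOT displayed here and consumed by nothing). -/
theorem grossBH2021_Fin1_iff :
    GrossBH2021_Thm3_1_uniqueness K (Fin 1) ↔
      ∀ c : maximalRealSubfield K, c ≠ 0 →
        (∀ v : HeightOneSpectrum (𝓞 (maximalRealSubfield K)), hilbertFin (maximalRealSubfield K) v c θ = 1) →
        (∀ φ : K →+* ℂ, 0 < (φ (algebraMap (maximalRealSubfield K) K c)).re) →
        ∃ z : K, z * star z = algebraMap (maximalRealSubfield K) K c :=
  ⟨fun hG _ hc hfin hpos => exists_mul_star_eq_of_grossBH2021_Fin1 hθ hy hG hc hfin hpos,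
    grossBH2021_Fin1_of_hasseNorm hθ hy⟩

include hθ hy in
/-- The same with the local condition read as «`c` is a local norm at `v`» (`c = x² − θ y²` in `K⁺_v`) and the
archimedean one on the real embeddings of `K⁺`: the classical wording of the Hasse norm theorem. -/
theorem grossBH2021_Fin1_iff_localNorm :
    GrossBH2021_Thm3_1_uniqueness K (Fin 1) ↔
      ∀ c : maximalRealSubfield K, c ≠ 0 →
        (∀ v : HeightOneSpectrum (𝓞 (maximalRealSubfield K)),
          IsNormSqrt (algebraMap (maximalRealSubfield K) (v.adicCompletion (maximalRealSubfield K)) θ)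
            (algebraMap (maximalRealSubfield K) (v.adicCompletion (maximalRealSubfield K)) c)) →
        (∀ ψ : maximalRealSubfield K →+* ℝ, 0 < ψ c) →
        ∃ z : K, z * star z = algebraMap (maximalRealSubfield K) K c := by
  rw [grossBH2021_Fin1_iff hθ hy]
  constructor
  · intro h c hc hfin hpos
    exact h c hc (fun v => (isNormSqrt_iff_hilbertFin_eq_one hθ hy v hc).mp (hfin v))
      ((totallyPositive_iff c).mpr hpos)
  · intro h c hc hfin hpos
    exact h c hc (fun v => (isNormSqrt_iff_hilbertFin_eq_one hθ hy v hc).mpr (hfin v))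
      ((totallyPositive_iff c).mp hpos)

end HasseNorm

end Summit.Ventures.HodgeRepro2.T5LandherrRankOne
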